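import Mathlib
import HarnessLib
import Summits.HubbardSuperconductivity.HubbardSuperconductivity.Theorems.KLProgrammeKLRegimeTwoVolumeSrcBlockStepDict
import Summits.HubbardSuperconductivity.HubbardSuperconductivity.Theorems.KLProgrammeKLRegimeEngineTowerParityUnits

/-!
# Route `KLProgramme` — crux K3, VL child `KLRegimeVolumeLimitV17F3` (stmt-HubbardSuperconductivity-23356), producer route «(VL)-SRC-SOFT» §S5b-1:
# GLUE FOR THE SOURCE TOWER'S BLOCK INDUCTION — rate monotonicity and parity of `klSrcPinnedSumAt`, the law units of `klWtBudget`, the absorption of the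
# two-scale closed form into ONE per-pair constant, the amplitude domination `W^{3^j}` (seat hubbard-kl-k3c4-p1 g19; `--supports` 23356)

Small lemmas every model-side use of `…TwoVolumeSrcBlockStepDict.klSrcPinnedSumAt_blockStep_le_twoScale` (S5a) needs when the blocks are chained (S5b):
* §1 `klSrcPinnedSumAt_anti_rate` (the tree weight decreases with the rate index: a profile at rate `k` bounds the profile at any `r ≥ k`),
  `klSrcActionAt_mem_evenPart`, `klSrcPinnedSumAt_eq_zero_of_odd` (odd degrees carry nothing — E1's `klWtPinnedSum_eq_zero_of_odd` for the doubled reading);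
* §2 `klWtBudget_two_mul_units` — `klWtBudget P Q U j (2d) = 2^{−5j}·(8^j)^d·(CE^d·ε_j^{max(1,d−1)})`: the law IS the block's units `Kc·u^d` times the dimensionless
  two-scale profile;
* §3 `twoScale_bracket_le` — the closed form of S5a in output half-degree `q+1` is `≤ (ΓR)^{q+1}·𝒦` with ONE per-pair constant `Γ·R`, `Γ = max 4 (2τψ)`,
  `𝒦 = (C+A)(1+8σR) + 2e·ŵ·ζ` (`Q ≤ R`, `λ ≤ 1`; no sign needed on `λ`);
* §4 `amp_dominate` — `16^{k+1}·G·W^{2·3^k} ≤ W^{3^{k+1}}` once `16·max(1,G) ≤ W`: the level-indexed amplitude `A_j := W^{3^j}` absorbs the block step's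
  factor `t_k^{−2} = 16^{k+1}W^{2·3^k}/t₀²` (memo SRC-SOFT-g19 §6, NOTES «S3c design v2»).
Pure algebra over landed definitions; nothing about the model is asserted; nothing asserts any stub, VL, K3 or superconductivity.
References: BGM 2006 §2.3 (2.17)–(2.23), §2.8 (2.83) [cite: BenfattoGiulianiMastropietro2006].
-/

noncomputable section

namespace Summit.HubbardSuperconductivity.HubbardSuperconductivity.Theorems.TwoVolumeDefect

set_option linter.dupNamespace false -- summit = problem name (single-conjunct summit), D-0017

open Real Finset Literature.MathematicalPhysics.QuantumLattice GrassmannAlgebra Literature.Probability.LatticeModels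
open Literature.Probability.LatticeModels.BattleFederbush
open Summit.HubbardSuperconductivity.HubbardSuperconductivity.Theorems.KLProgrammeLegKernels
open Summit.HubbardSuperconductivity.HubbardSuperconductivity.Theorems.KLRegimeSplit
open Summit.HubbardSuperconductivity.HubbardSuperconductivity.Theorems.EngineV8
open Summit.HubbardSuperconductivity.HubbardSuperconductivity.Theorems.TwoVolumeSource

/-! ## §1 Rate monotonicity and parity of the source-graded pinned sums -/

section Model

variable {L M : ℕ}

/-- **The source-graded pinned sum decreases with the rate index**: `r ≤ r′ ⇒ klSrcPinnedSumAt … J r′ n … ≤ klSrcPinnedSumAt … J r n …` (`0 ≤ β`). -/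
theorem klSrcPinnedSumAt_anti_rate [NeZero L] {β : ℝ} (hβ : 0 ≤ β) (U μ : ℝ) (K : TrigPolyC4v) (J n s m : ℕ) {r r' : ℕ} (h : r ≤ r')
    (q : Fin m) (w : SrcLabel L M J) :
    klSrcPinnedSumAt L M β U μ K J r' n s m q w ≤ klSrcPinnedSumAt L M β U μ K J r n s m q w := by
  rw [klSrcPinnedSumAt_def, klSrcPinnedSumAt_def]
  exact mul_le_mul_of_nonneg_left (sum_le_sum fun X _ => mul_le_mul_of_nonneg_right (klScaleWt_le_of_le β h _) (norm_nonneg _))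
    (pow_nonneg (imagTimeWeight_nonneg hβ M) _)

/-- The doubled-analysed action is even (`β ≠ 0`). -/
theorem klSrcActionAt_mem_evenPart [NeZero L] [NeZero M] {β : ℝ} (hβ : β ≠ 0) (U μ : ℝ) (K : TrigPolyC4v) (J n : ℕ) :
    klSrcActionAt L M β U μ K J n ∈ evenPart ℂ (SrcLabel L M J) := by
  unfold klSrcActionAt
  exact mem_evenPart_iff.2 (map_mem_evenOdd_zero ℂ _ (mem_evenPart_iff.1 (klEffectiveAction_mem_evenPart hβ U μ K klE0 n)))

/-- **Odd degrees carry nothing**: `klSrcPinnedSumAt … m q w = 0` for odd `m` (`β ≠ 0`). -/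
theorem klSrcPinnedSumAt_eq_zero_of_odd [NeZero L] [NeZero M] {β : ℝ} (hβ : β ≠ 0) (U μ : ℝ) (K : TrigPolyC4v) (J r n s : ℕ) {m : ℕ} (hm : Odd m)
    (q : Fin m) (w : SrcLabel L M J) : klSrcPinnedSumAt L M β U μ K J r n s m q w = 0 := by
  rw [klSrcPinnedSumAt_def]
  refine mul_eq_zero_of_right _ (sum_eq_zero fun X _ => ?_)
  rw [kernel_eq_zero_of_mem_evenPart_of_odd ℂ (klSrcActionAt_mem_evenPart hβ U μ K J n) hm X, norm_zero, mul_zero]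

end Model

/-! ## §2 The law is the block's units times the dimensionless profile -/

/-- `2^{(3d−5)j} = 2^{−5j}·(8^j)^d` over `ℝ` (integer exponent on the left). -/
theorem two_zpow_law_units (d j : ℕ) : (2 : ℝ) ^ ((3 * (d : ℤ) - 5) * j) = ((2 : ℝ) ^ (5 * j))⁻¹ * ((8 : ℝ) ^ j) ^ d := by
  have h2 : (2 : ℝ) ≠ 0 := by norm_num
  rw [show (3 * (d : ℤ) - 5) * j = ((3 * d * j : ℕ) : ℤ) - ((5 * j : ℕ) : ℤ) by push_cast; ring, zpow_sub₀ h2, zpow_natCast, zpow_natCast,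
    div_eq_mul_inv, mul_comm]
  congr 1
  rw [show (8 : ℝ) = 2 ^ 3 by norm_num, ← pow_mul, ← pow_mul]
  congr 1
  ring

/-- **`klWtBudget` in units**: `klWtBudget P Q U j (2d) = 2^{−5j}·(8^j)^d·(CE^d·ε_j^{max(1,d−1)})`. -/
theorem klWtBudget_two_mul_units (P : SplitConsts) (Q : EngConsts) (U : ℝ) (j d : ℕ) :
    klWtBudget P Q U j (2 * d) = ((2 : ℝ) ^ (5 * j))⁻¹ * ((8 : ℝ) ^ j) ^ d * (Q.CE ^ d * epsCoupling P U j ^ max 1 (d - 1)) := by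
  rw [klWtBudget_two_mul, two_zpow_law_units]
  ring

/-! ## §3 One per-pair constant absorbs the two-scale closed form -/

/-- **Absorption**: for `0 ≤ Q ≤ R`, `0 ≤ λ ≤ 1` and nonnegative constants,
`CQ^{q+1} + AR^{q+1} + [(C+A)λ(4R)^{q+1}·8σR + 2e·ŵ·ζ·(2τψR)^{q+1}] ≤ (max 4 (2τψ)·R)^{q+1}·[(C+A)(1+8σR) + 2e·ŵ·ζ]`. -/
theorem twoScale_bracket_le {C A Q R lam σ τ ψ w ζ : ℝ} (hC : 0 ≤ C) (hA : 0 ≤ A) (hQ : 0 ≤ Q) (hQR : Q ≤ R) (hlam1 : lam ≤ 1)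
    (hσ : 0 ≤ σ) (hτ : 0 ≤ τ) (hψ : 0 ≤ ψ) (hw : 0 ≤ w) (hζ : 0 ≤ ζ) (q : ℕ) :
    C * Q ^ (q + 1) + A * R ^ (q + 1) + ((C + A) * lam * ((4 * R) ^ (q + 1) * (8 * σ * R)) + 2 * Real.exp 1 * w * ζ * (2 * τ * ψ * R) ^ (q + 1)) ≤
      (max 4 (2 * τ * ψ) * R) ^ (q + 1) * ((C + A) * (1 + 8 * σ * R) + 2 * Real.exp 1 * w * ζ) := by
  have hR : 0 ≤ R := hQ.trans hQR
  set Γ : ℝ := max 4 (2 * τ * ψ) with hΓ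
  have hΓ4 : 4 ≤ Γ := le_max_left _ _
  have hΓτ : 2 * τ * ψ ≤ Γ := le_max_right _ _
  have hΓ1 : 1 ≤ Γ := le_trans (by norm_num) hΓ4
  have hRΓ : R ≤ Γ * R := le_mul_of_one_le_left hR hΓ1
  have h1 : Q ^ (q + 1) ≤ (Γ * R) ^ (q + 1) := pow_le_pow_left₀ hQ (hQR.trans hRΓ) _
  have h2 : R ^ (q + 1) ≤ (Γ * R) ^ (q + 1) := pow_le_pow_left₀ hR hRΓ _
  have h3 : (4 * R) ^ (q + 1) ≤ (Γ * R) ^ (q + 1) := pow_le_pow_left₀ (by positivity) (mul_le_mul_of_nonneg_right hΓ4 hR) _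
  have h4 : (2 * τ * ψ * R) ^ (q + 1) ≤ (Γ * R) ^ (q + 1) := pow_le_pow_left₀ (by positivity) (mul_le_mul_of_nonneg_right hΓτ hR) _
  have hX : 0 ≤ (Γ * R) ^ (q + 1) := by positivity
  have hCA : 0 ≤ C + A := add_nonneg hC hA
  have hlamle : (C + A) * lam ≤ C + A := mul_le_of_le_one_right hCA hlam1
  calc C * Q ^ (q + 1) + A * R ^ (q + 1) + ((C + A) * lam * ((4 * R) ^ (q + 1) * (8 * σ * R)) + 2 * Real.exp 1 * w * ζ * (2 * τ * ψ * R) ^ (q + 1))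
      ≤ C * (Γ * R) ^ (q + 1) + A * (Γ * R) ^ (q + 1) +
          ((C + A) * ((Γ * R) ^ (q + 1) * (8 * σ * R)) + 2 * Real.exp 1 * w * ζ * (Γ * R) ^ (q + 1)) := by
        have ha : C * Q ^ (q + 1) ≤ C * (Γ * R) ^ (q + 1) := mul_le_mul_of_nonneg_left h1 hC
        have hb : A * R ^ (q + 1) ≤ A * (Γ * R) ^ (q + 1) := mul_le_mul_of_nonneg_left h2 hA
        have hc : (C + A) * lam * ((4 * R) ^ (q + 1) * (8 * σ * R)) ≤ (C + A) * ((Γ * R) ^ (q + 1) * (8 * σ * R)) :=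
          mul_le_mul hlamle (mul_le_mul_of_nonneg_right h3 (by positivity)) (by positivity) hCA
        have hd : 2 * Real.exp 1 * w * ζ * (2 * τ * ψ * R) ^ (q + 1) ≤ 2 * Real.exp 1 * w * ζ * (Γ * R) ^ (q + 1) :=
          mul_le_mul_of_nonneg_left h4 (by positivity)
        linarith
    _ = (Γ * R) ^ (q + 1) * ((C + A) * (1 + 8 * σ * R) + 2 * Real.exp 1 * w * ζ) := by ring

/-! ## §4 The level-indexed amplitude `W^{3^j}` absorbs the block step's factor -/

/-- **Amplitude domination**: `16^{k+1}·G·W^{2·3^k} ≤ W^{3^{k+1}}` whenever `16·max(1,G) ≤ W`. -/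
theorem amp_dominate {G W : ℝ} (hW : 16 * max 1 G ≤ W) (k : ℕ) :
    (16 : ℝ) ^ (k + 1) * G * W ^ (2 * 3 ^ k) ≤ W ^ (3 ^ (k + 1)) := by
  have hm1 : (1 : ℝ) ≤ max 1 G := le_max_left _ _
  have hm0 : (0 : ℝ) ≤ 16 * max 1 G := by positivity
  have hW1 : 1 ≤ W := le_trans (by linarith) hW
  have hW0 : 0 ≤ W := zero_le_one.trans hW1
  have h3 : k + 1 ≤ 3 ^ k := Nat.lt_pow_self (by norm_num : 1 < 3)
  have hGm : G ≤ (max 1 G) ^ (k + 1) := (le_max_right 1 G).trans (le_self_pow₀ hm1 (by omega))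
  calc (16 : ℝ) ^ (k + 1) * G * W ^ (2 * 3 ^ k) ≤ (16 : ℝ) ^ (k + 1) * (max 1 G) ^ (k + 1) * W ^ (2 * 3 ^ k) := by
        gcongr
    _ = (16 * max 1 G) ^ (k + 1) * W ^ (2 * 3 ^ k) := by rw [mul_pow]
    _ ≤ W ^ (k + 1) * W ^ (2 * 3 ^ k) := mul_le_mul_of_nonneg_right (pow_le_pow_left₀ hm0 hW _) (by positivity)
    _ ≤ W ^ (3 ^ k) * W ^ (2 * 3 ^ k) := mul_le_mul_of_nonneg_right (pow_le_pow_right₀ hW1 h3) (by positivity)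
    _ = W ^ (3 ^ (k + 1)) := by rw [← pow_add, pow_succ]; ring_nf

end Summit.HubbardSuperconductivity.HubbardSuperconductivity.Theorems.TwoVolumeDefect

end
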